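import Mathlib
import HarnessLib
import Summits.ValiantsHypothesis.ValiantsHypothesis.Theses.MonotoneRestoration
import Literature.Computability.AlgebraicComplexity.ArithCircuit
import Literature.Computability.AlgebraicComplexity.ArithCircuitProofs
import Literature.Computability.AlgebraicComplexity.MonotoneStructure
import Literature.Computability.AlgebraicComplexity.PermanentIrreducible
import Literature.ModelTheory.FiniteModelTheory.CkEquiv
import Summits.ValiantsHypothesis.ValiantsHypothesis.Theorems.MonotoneRestorationMonotoneRestorationQPCosetCount
import Summits.ValiantsHypothesis.ValiantsHypothesis.Theorems.MonotoneRestorationMonotoneRestorationQPSymmetricLB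
import Summits.ValiantsHypothesis.ValiantsHypothesis.Theorems.MonotoneRestorationMonotoneRestorationQPSupportSymmetrisation
import Summits.ValiantsHypothesis.ValiantsHypothesis.Theorems.MonotoneRestorationMonotoneRestorationQPSparseRegime
import Summits.ValiantsHypothesis.ValiantsHypothesis.Theorems.MonotoneRestorationMonotoneRestorationQPBeta
import Literature.Computability.AlgebraicComplexity.SymmetricArithCircuit
import Literature.Computability.AlgebraicComplexity.DawarWilsenach2025Proofs
import Literature.GroupTheory.PermutationGroups.SmallIndexSubgroups
import Summits.ValiantsHypothesis.ValiantsHypothesis.Theorems.MonotoneRestorationQP.Negative.LoadBearing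
import Summits.ValiantsHypothesis.ValiantsHypothesis.Theorems.MonotoneRestorationMonotoneRestorationQPPermSupportCount

/-! TTRL-lite variant V19249 of stmt-ValiantsHypothesis-15886 -/

-- `Summit.ValiantsHypothesis.ValiantsHypothesis.…` is the tree's mandated single-conjunct layout
-- (Sub = Summit), so the duplicated namespace component is intended.
set_option linter.dupNamespace false

namespace Summit.ValiantsHypothesis.ValiantsHypothesis.Theorems

open Summit.ValiantsHypothesis.ValiantsHypothesis.Theses.MonotoneRestoration
open Literature.Computability.AlgebraicComplexity

/-- Degree ladder, `d = 1` (TTRL-lite variant V19249 of stmt-ValiantsHypothesis-15886,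
`stub_esymmRowSums_complexity`): substituting the row sums `Rᵢ = ∑ⱼ X (i, j)` of the generic
`n × n` matrix into `e₁` gives `∑ᵢ ∑ⱼ X (i, j)`, whose monotone (semiring `ℝ≥0`) circuit
complexity is at most `n · n + n ≤ (n + 2) ^ 2`: variables are free and iterated subadditivity
charges one addition gate per summand, first inside each row and then across the rows
(no sharing needed). -/
theorem stub_esymmRowSums_complexity_var19249 :
    ∀ n : ℕ, complexity (MvPolynomial.bind₁ (fun i : Fin n => ∑ j : Fin n, MvPolynomial.X (i, j))
      (MvPolynomial.esymm (Fin n) NNReal 1)) ≤ (n + 2) ^ 2 := by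
  intro n
  rw [MvPolynomial.esymm_one, map_sum]
  simp only [MvPolynomial.bind₁_X_right]
  -- each row sum costs at most `n` gates
  have hrow : ∀ i ∈ (Finset.univ : Finset (Fin n)), complexity (∑ j : Fin n,
      (MvPolynomial.X (i, j) : MvPolynomial (Fin n × Fin n) NNReal)) ≤ n := by
    intro i _
    refine (complexity_finset_sum_le _ _).trans ?_
    have h0 : ∀ j ∈ (Finset.univ : Finset (Fin n)),
        complexity (MvPolynomial.X (i, j) : MvPolynomial (Fin n × Fin n) NNReal) = 0 :=
      fun j _ => complexity_X_holds _
    rw [Finset.sum_eq_zero h0, zero_add, Finset.card_univ, Fintype.card_fin]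
  refine (complexity_finset_sum_le _ _).trans ?_
  calc ∑ i : Fin n, complexity (∑ j : Fin n,
          (MvPolynomial.X (i, j) : MvPolynomial (Fin n × Fin n) NNReal))
          + (Finset.univ : Finset (Fin n)).card
        ≤ ∑ _i : Fin n, n + (Finset.univ : Finset (Fin n)).card := by
          gcongr with i hi
          exact hrow i hi
    _ = n * n + n := by
          rw [Finset.sum_const, Finset.card_univ, Fintype.card_fin, smul_eq_mul]
    _ ≤ (n + 2) ^ 2 := by nlinarith

end Summit.ValiantsHypothesis.ValiantsHypothesis.Theorems
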